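import Mathlib
import HarnessLib
import Literature.Analysis.FluidPDE.ClassicalSolutionRegion
import Summits.NavierStokesRegularity.NavierStokesRegularity.Theorems.PoloidalWindowDoorPoloidalWindowRigidityWindow
import Summits.NavierStokesRegularity.NavierStokesRegularity.Theorems.AdaptedFrequencyTangentFlowTransferAncientPressure

/-!
# Route `PoloidalWindowDoor`, crux `PoloidalWindowRigidity` (K2, stmt-NavierStokesRegularity-19708) — the registered stub
# `stub_hyperbolicThick` of the line `Cruxes/PoloidalWindowRigidity/Lines/mixed_type.lean` (v1), VERBATIM, from ONE
# class-free LOCAL statement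

Cell ns-regularity-ideate, seat ns-poloidal-K2-p4 gen 0 (stub-worker on `mixed_type::stub_hyperbolicThick` = the (R-THICK)
residue of `Cruxes/PoloidalWindowRigidity/Disproof.lean::stubTwisting_iff_residues`, restricted to the hyperbolic type; lead of
record ns-poloidal-K2-p2; file landed `--supports stmt-NavierStokesRegularity-19708` as a helper).

`stub_hyperbolicThick` says: a profile of the route's Type-I ancient mild class, poloidal along `e₃`, cannot carry a nonempty
open window which is non-degenerate, (TV)-pinned, twisting, HYPERBOLIC (`⟪∂₂vₕ, ∇ₕv₂⟫ < 0`, the kinematic identity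
`∂₂²v₂ + divₕ(∂₂vₕ) = 0` is a wave equation with the height as time) and THICK (the shear slope is a function of `(t, x₂)` on
NO nonempty open sub-window) — conclusion in the currency `¬ IsBackwardSingularPoint v 0`.

This file proves it from either of two LOCAL statements about real-analytic classical Navier–Stokes germs (no Type-I rate, no
ancient-ness, no apex, no mild formulation — the class is consumed once, here, through the tree theorems
`…Window.isTypeIAncientMild_of_class`, `…AdaptedFrequencyTangentFlowTransferAncientPressure.exists_isClassicalNSSolutionOn_Iio_of_isTypeIAncientMild`
(a classical pressure on the slab), `IsClassicalNSSolutionOn.onRegion` / `IsClassicalNSSolutionOnRegion.mono_of_isOpen`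
(restriction to the window) and `…Ancient.analyticOnNhd_uncurry` (joint real-analyticity)):

* `stub_hyperbolicThick_of_localThickTH` — from the statement of the registered stub `stub_localThickTH` (S2) of the
  crux-strategist's line `Cruxes/PoloidalWindowRigidity/Lines/local_rigidity.lean` (v1), VERBATIM as hypothesis: «every
  twisting non-degenerate poloidal real-analytic classical NS germ on an open `U` is time–height (`∂₂u_b = m(t,y₂)∂_bu₂`,
  `b = 0,1`) on some nonempty open `U₁ ⊆ U`».  So ONE certificate for S2 closes this stub as well, by name.
* `stub_hyperbolicThick_of_localHypThick` — from the strictly WEAKER local statement in which the germ is moreover assumed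
  HYPERBOLIC at every point of `U` (`∂₂u₀·∂₀u₂ + ∂₂u₁·∂₁u₂ < 0`): the by-name local target of the THICK ∩ HYPERBOLIC column
  of `mixed_type` (a certificate may use the sign — e.g. the real characteristic cone of `∂₂²w = divₕ(|Λ|∇ₕw)`).

In both, the thick hypothesis of the stub (for every `m` and every nonempty open `W₁ ⊆ W` a point of `W₁` violates
`∂₂v_b = m(t,y₂)∂_bv₂`) contradicts the local conclusion on `U₁ ⊆ W` directly; the (TV)-pin and the hyperbolicity are passed
through or unused.  Kinematic thick twisting germs exist locally (Cauchy–Kovalevskaya for `u_zz + Δₕ[G(u,z)] = 0` with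
`G_uu ≠ 0`, refuter1 K-48), so the momentum clause `IsClassicalNSSolutionOnRegion` of the local statements is load-bearing,
exactly as (M) is for the stub (`…Negative.*FalseWithoutMild`).

WHAT THIS IS NOT: not a proof of `stub_hyperbolicThick`, of the crux, or of anything about Navier–Stokes regularity (Clay (A)
untouched) — a kernel-checked LOCALISATION: the class-level THICK ∩ hyperbolic residue is closed MODULO one named local
PDE statement, the common target of the cell's elimination engines (cert-1, nsreg-p7) and of refuter1's K-49 inhabitant hunt.
bears_on LADDER-NS N0, crux 19708 (line mixed_type, stub `stub_hyperbolicThick`; line local_rigidity, stub S2).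
-/

noncomputable section

-- the summit and its single sub-problem share the name (CONVENTIONS §1), as in every Theorems file
set_option linter.dupNamespace false

namespace Summit.NavierStokesRegularity.NavierStokesRegularity.Theorems.PoloidalWindowDoorPoloidalWindowRigidityHyperbolicThickOfLocal

open Set Function
open scoped RealInnerProductSpace InnerProductSpace
open Literature.Analysis Literature.Analysis.FluidPDE
open Summit.NavierStokesRegularity.NavierStokesRegularity.Theorems
open Summit.NavierStokesRegularity.NavierStokesRegularity.Theorems.PoloidalWindowDoorPoloidalWindowRigidityWindow
open Summit.NavierStokesRegularity.NavierStokesRegularity.Theorems.LocalSineTubeDoorProfileAlignedWindowRigidityAncient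

/-- **`stub_hyperbolicThick` (line `mixed_type` v1) VERBATIM, from the hyperbolic local statement.**  Hypothesis
`hloc`: every real-analytic classical NS pair `(u, q)` on a nonempty open space–time set `U`, poloidal along `e₃`,
non-degenerate, twisting and HYPERBOLIC (`∂₂u₀·∂₀u₂ + ∂₂u₁·∂₁u₂ < 0`) at every point of `U`, is time–height on some nonempty
open `U₁ ⊆ U`.  Proof: the class profile is a jointly analytic classical solution on the window `W` (tree); `hloc` on `U := W`
gives `(U₁, m)`; the stub's thick hypothesis at `(m, U₁)` gives a point of `U₁` violating the (TH) law — contradiction. -/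
theorem stub_hyperbolicThick_of_localHypThick
    (hloc : ∀ (u : ℝ → EuclideanSpace ℝ (Fin 3) → EuclideanSpace ℝ (Fin 3)) (q : ℝ → EuclideanSpace ℝ (Fin 3) → ℝ)
        (U : Set (ℝ × EuclideanSpace ℝ (Fin 3))),
        IsOpen U → U.Nonempty →
        Literature.Analysis.FluidPDE.IsClassicalNSSolutionOnRegion U 1 0 u q →
        AnalyticOnNhd ℝ (Function.uncurry u) U →
        (∀ p ∈ U, ⟪Literature.Analysis.FluidPDE.curl (u p.1) p.2, EuclideanSpace.single 2 1⟫_ℝ = 0) →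
        (∀ p ∈ U, Literature.Analysis.FluidPDE.curl (u p.1) p.2 ≠ 0 ∧
          (fderiv ℝ (u p.1) p.2 (EuclideanSpace.single 0 1) 2 ≠ 0 ∨ fderiv ℝ (u p.1) p.2 (EuclideanSpace.single 1 1) 2 ≠ 0) ∧
          (fderiv ℝ (u p.1) p.2 (EuclideanSpace.single 2 1) 0 ≠ 0 ∨ fderiv ℝ (u p.1) p.2 (EuclideanSpace.single 2 1) 1 ≠ 0)) →
        (∀ p ∈ U,
          fderiv ℝ (fun y => fderiv ℝ (u p.1) y (EuclideanSpace.single 2 1) 2) p.2 (EuclideanSpace.single 0 1) *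
              fderiv ℝ (u p.1) p.2 (EuclideanSpace.single 1 1) 2 -
            fderiv ℝ (fun y => fderiv ℝ (u p.1) y (EuclideanSpace.single 2 1) 2) p.2 (EuclideanSpace.single 1 1) *
              fderiv ℝ (u p.1) p.2 (EuclideanSpace.single 0 1) 2 ≠ 0) →
        (∀ p ∈ U,
          fderiv ℝ (u p.1) p.2 (EuclideanSpace.single 2 1) 0 * fderiv ℝ (u p.1) p.2 (EuclideanSpace.single 0 1) 2 +
            fderiv ℝ (u p.1) p.2 (EuclideanSpace.single 2 1) 1 * fderiv ℝ (u p.1) p.2 (EuclideanSpace.single 1 1) 2 < 0) →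
        ∃ U₁ : Set (ℝ × EuclideanSpace ℝ (Fin 3)), U₁ ⊆ U ∧ IsOpen U₁ ∧ U₁.Nonempty ∧
          ∃ m : ℝ → ℝ → ℝ, ∀ p ∈ U₁, ∀ b : Fin 3, b ≠ 2 →
            fderiv ℝ (u p.1) p.2 (EuclideanSpace.single 2 1) b =
              m p.1 (p.2 2) * fderiv ℝ (u p.1) p.2 (EuclideanSpace.single b 1) 2) :
    ∀ (C : ℝ) (v : ℝ → EuclideanSpace ℝ (Fin 3) → EuclideanSpace ℝ (Fin 3)),
      Literature.Analysis.FluidPDE.HasTypeITimeDecay C v →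
      ContinuousOn (Function.uncurry v) (Set.Iio (0 : ℝ) ×ˢ Set.univ) →
      (∀ s t : ℝ, s < t → t < 0 → ∀ x, v t x =
        Literature.Analysis.UnboundedOperators.heatExtension (v s) (t - s) x -
          Literature.Analysis.FluidPDE.oseenDuhamel 1 s v v t x) →
      (∀ t < 0, Literature.Analysis.FluidPDE.VectorCalculus.IsDivFree (v t)) →
      (∀ s < 0, ∀ y, ⟪Literature.Analysis.FluidPDE.curl (v s) y, EuclideanSpace.single 2 1⟫_ℝ = 0) →
      ∀ W : Set (ℝ × EuclideanSpace ℝ (Fin 3)), IsOpen W → W.Nonempty → W ⊆ Set.Iio (0 : ℝ) ×ˢ Set.univ →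
        (∀ z ∈ W, Literature.Analysis.FluidPDE.curl (v z.1) z.2 ≠ 0 ∧
          (fderiv ℝ (v z.1) z.2 (EuclideanSpace.single 0 1) 2 ≠ 0 ∨ fderiv ℝ (v z.1) z.2 (EuclideanSpace.single 1 1) 2 ≠ 0) ∧
          (fderiv ℝ (v z.1) z.2 (EuclideanSpace.single 2 1) 0 ≠ 0 ∨ fderiv ℝ (v z.1) z.2 (EuclideanSpace.single 2 1) 1 ≠ 0)) →
        (∀ m : ℝ → ℝ, ∀ W₁ : Set (ℝ × EuclideanSpace ℝ (Fin 3)), W₁ ⊆ W → IsOpen W₁ → W₁.Nonempty →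
          ∃ z ∈ W₁, ∃ b : Fin 3, b ≠ 2 ∧
            fderiv ℝ (v z.1) z.2 (EuclideanSpace.single 2 1) b ≠
              m z.1 * fderiv ℝ (v z.1) z.2 (EuclideanSpace.single b 1) 2) →
        (∀ z ∈ W,
          fderiv ℝ (fun x => fderiv ℝ (v z.1) x (EuclideanSpace.single 2 1) 2) z.2 (EuclideanSpace.single 0 1) *
              fderiv ℝ (v z.1) z.2 (EuclideanSpace.single 1 1) 2 -
            fderiv ℝ (fun x => fderiv ℝ (v z.1) x (EuclideanSpace.single 2 1) 2) z.2 (EuclideanSpace.single 1 1) *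
              fderiv ℝ (v z.1) z.2 (EuclideanSpace.single 0 1) 2 ≠ 0) →
        (∀ z ∈ W,
          fderiv ℝ (v z.1) z.2 (EuclideanSpace.single 2 1) 0 * fderiv ℝ (v z.1) z.2 (EuclideanSpace.single 0 1) 2 +
            fderiv ℝ (v z.1) z.2 (EuclideanSpace.single 2 1) 1 * fderiv ℝ (v z.1) z.2 (EuclideanSpace.single 1 1) 2 < 0) →
        (∀ m : ℝ → ℝ → ℝ, ∀ W₁ : Set (ℝ × EuclideanSpace ℝ (Fin 3)), W₁ ⊆ W → IsOpen W₁ → W₁.Nonempty →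
          ∃ z ∈ W₁, ∃ b : Fin 3, b ≠ 2 ∧
            fderiv ℝ (v z.1) z.2 (EuclideanSpace.single 2 1) b ≠
              m z.1 (z.2 2) * fderiv ℝ (v z.1) z.2 (EuclideanSpace.single b 1) 2) →
        ¬ Literature.Analysis.FluidPDE.IsBackwardSingularPoint v 0 := by
  intro C v hrate hcont hmild hdiv hpol W hW hWne hWs hnd _hpin htw hhyp hthick
  -- ## the class profile is a classical solution on the slab, hence on the window, and jointly analytic there
  obtain ⟨q, hq⟩ := exists_isClassicalNSSolutionOn_Iio_of_isTypeIAncientMild (isTypeIAncientMild_of_class hrate hcont hmild hdiv)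
  have hreg : IsClassicalNSSolutionOnRegion W 1 0 v q := hq.onRegion.mono_of_isOpen hWs hW
  have han : AnalyticOnNhd ℝ (uncurry v) W := fun z hz =>
    (analyticOnNhd_uncurry hcont (bdd_of_hasTypeITimeDecay hrate) hmild) z (hWs hz)
  have hpolW : ∀ z ∈ W, ⟪curl (v z.1) z.2, EuclideanSpace.single 2 1⟫_ℝ = 0 := fun z hz =>
    hpol z.1 (Set.mem_prod.1 (hWs hz)).1 z.2
  -- ## the local statement: a (TH) sub-window, contradicting thickness
  obtain ⟨U₁, hU₁W, hU₁o, hU₁ne, m, hm⟩ := hloc v q W hW hWne hreg han hpolW hnd htw hhyp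
  obtain ⟨z, hz, b, hb, hne⟩ := hthick m U₁ hU₁W hU₁o hU₁ne
  exact absurd (hm z hz b hb) hne

/-- **`stub_hyperbolicThick` (line `mixed_type` v1) VERBATIM, from the registered stub `stub_localThickTH` (S2) of the line
`local_rigidity` v1, VERBATIM as hypothesis** (the hyperbolicity hypothesis of the stub is then simply not used). -/
theorem stub_hyperbolicThick_of_localThickTH
    (hS2 : ∀ (u : ℝ → EuclideanSpace ℝ (Fin 3) → EuclideanSpace ℝ (Fin 3)) (q : ℝ → EuclideanSpace ℝ (Fin 3) → ℝ)
        (U : Set (ℝ × EuclideanSpace ℝ (Fin 3))),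
        IsOpen U → U.Nonempty →
        Literature.Analysis.FluidPDE.IsClassicalNSSolutionOnRegion U 1 0 u q →
        AnalyticOnNhd ℝ (Function.uncurry u) U →
        (∀ p ∈ U, ⟪Literature.Analysis.FluidPDE.curl (u p.1) p.2, EuclideanSpace.single 2 1⟫_ℝ = 0) →
        (∀ p ∈ U, Literature.Analysis.FluidPDE.curl (u p.1) p.2 ≠ 0 ∧
          (fderiv ℝ (u p.1) p.2 (EuclideanSpace.single 0 1) 2 ≠ 0 ∨ fderiv ℝ (u p.1) p.2 (EuclideanSpace.single 1 1) 2 ≠ 0) ∧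
          (fderiv ℝ (u p.1) p.2 (EuclideanSpace.single 2 1) 0 ≠ 0 ∨ fderiv ℝ (u p.1) p.2 (EuclideanSpace.single 2 1) 1 ≠ 0)) →
        (∀ p ∈ U,
          fderiv ℝ (fun y => fderiv ℝ (u p.1) y (EuclideanSpace.single 2 1) 2) p.2 (EuclideanSpace.single 0 1) *
              fderiv ℝ (u p.1) p.2 (EuclideanSpace.single 1 1) 2 -
            fderiv ℝ (fun y => fderiv ℝ (u p.1) y (EuclideanSpace.single 2 1) 2) p.2 (EuclideanSpace.single 1 1) *
              fderiv ℝ (u p.1) p.2 (EuclideanSpace.single 0 1) 2 ≠ 0) →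
        ∃ U₁ : Set (ℝ × EuclideanSpace ℝ (Fin 3)), U₁ ⊆ U ∧ IsOpen U₁ ∧ U₁.Nonempty ∧
          ∃ m : ℝ → ℝ → ℝ, ∀ p ∈ U₁, ∀ b : Fin 3, b ≠ 2 →
            fderiv ℝ (u p.1) p.2 (EuclideanSpace.single 2 1) b =
              m p.1 (p.2 2) * fderiv ℝ (u p.1) p.2 (EuclideanSpace.single b 1) 2) :
    ∀ (C : ℝ) (v : ℝ → EuclideanSpace ℝ (Fin 3) → EuclideanSpace ℝ (Fin 3)),
      Literature.Analysis.FluidPDE.HasTypeITimeDecay C v →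
      ContinuousOn (Function.uncurry v) (Set.Iio (0 : ℝ) ×ˢ Set.univ) →
      (∀ s t : ℝ, s < t → t < 0 → ∀ x, v t x =
        Literature.Analysis.UnboundedOperators.heatExtension (v s) (t - s) x -
          Literature.Analysis.FluidPDE.oseenDuhamel 1 s v v t x) →
      (∀ t < 0, Literature.Analysis.FluidPDE.VectorCalculus.IsDivFree (v t)) →
      (∀ s < 0, ∀ y, ⟪Literature.Analysis.FluidPDE.curl (v s) y, EuclideanSpace.single 2 1⟫_ℝ = 0) →
      ∀ W : Set (ℝ × EuclideanSpace ℝ (Fin 3)), IsOpen W → W.Nonempty → W ⊆ Set.Iio (0 : ℝ) ×ˢ Set.univ →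
        (∀ z ∈ W, Literature.Analysis.FluidPDE.curl (v z.1) z.2 ≠ 0 ∧
          (fderiv ℝ (v z.1) z.2 (EuclideanSpace.single 0 1) 2 ≠ 0 ∨ fderiv ℝ (v z.1) z.2 (EuclideanSpace.single 1 1) 2 ≠ 0) ∧
          (fderiv ℝ (v z.1) z.2 (EuclideanSpace.single 2 1) 0 ≠ 0 ∨ fderiv ℝ (v z.1) z.2 (EuclideanSpace.single 2 1) 1 ≠ 0)) →
        (∀ m : ℝ → ℝ, ∀ W₁ : Set (ℝ × EuclideanSpace ℝ (Fin 3)), W₁ ⊆ W → IsOpen W₁ → W₁.Nonempty →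
          ∃ z ∈ W₁, ∃ b : Fin 3, b ≠ 2 ∧
            fderiv ℝ (v z.1) z.2 (EuclideanSpace.single 2 1) b ≠
              m z.1 * fderiv ℝ (v z.1) z.2 (EuclideanSpace.single b 1) 2) →
        (∀ z ∈ W,
          fderiv ℝ (fun x => fderiv ℝ (v z.1) x (EuclideanSpace.single 2 1) 2) z.2 (EuclideanSpace.single 0 1) *
              fderiv ℝ (v z.1) z.2 (EuclideanSpace.single 1 1) 2 -
            fderiv ℝ (fun x => fderiv ℝ (v z.1) x (EuclideanSpace.single 2 1) 2) z.2 (EuclideanSpace.single 1 1) *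
              fderiv ℝ (v z.1) z.2 (EuclideanSpace.single 0 1) 2 ≠ 0) →
        (∀ z ∈ W,
          fderiv ℝ (v z.1) z.2 (EuclideanSpace.single 2 1) 0 * fderiv ℝ (v z.1) z.2 (EuclideanSpace.single 0 1) 2 +
            fderiv ℝ (v z.1) z.2 (EuclideanSpace.single 2 1) 1 * fderiv ℝ (v z.1) z.2 (EuclideanSpace.single 1 1) 2 < 0) →
        (∀ m : ℝ → ℝ → ℝ, ∀ W₁ : Set (ℝ × EuclideanSpace ℝ (Fin 3)), W₁ ⊆ W → IsOpen W₁ → W₁.Nonempty →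
          ∃ z ∈ W₁, ∃ b : Fin 3, b ≠ 2 ∧
            fderiv ℝ (v z.1) z.2 (EuclideanSpace.single 2 1) b ≠
              m z.1 (z.2 2) * fderiv ℝ (v z.1) z.2 (EuclideanSpace.single b 1) 2) →
        ¬ Literature.Analysis.FluidPDE.IsBackwardSingularPoint v 0 := by
  refine stub_hyperbolicThick_of_localHypThick ?_
  intro u q U hU hUne hreg han hpol hnd htw _hhyp
  exact hS2 u q U hU hUne hreg han hpol hnd htw

end Summit.NavierStokesRegularity.NavierStokesRegularity.Theorems.PoloidalWindowDoorPoloidalWindowRigidityHyperbolicThickOfLocal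

end
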